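import Literature.NumberTheory.Automorphic.ArchLocalTorusOrbitalContinuity   -- ★ p839258 FILE A (F0P3a-p06 (g9)): per-place joint properness ∕ continuity on `T_reg`
import Literature.NumberTheory.Automorphic.ArchStableClassRegularTorus       -- ★ (F0P3a-p02 (g9)): `archPiEquivCM_archDiagTorus` (`t(z)_w = diag(z_w)`)
import Literature.NumberTheory.Automorphic.ArchTorusRegularDense             -- ★ `Literature.Topology.isOpen_setOf_forall_injective` (the global regular set is open)
import HarnessLib

/-!
# The GLOBAL torus orbital function on `G′_∞ = U(diag α)(L⁺ ⊗ ℝ)` is continuous on the regular set (ROAD-Sd (V2)-glob, FILE B)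

Topic `NumberTheory/Automorphic`; namespace `Literature.NumberTheory.Automorphic.UnitaryGroup`.  THEOREMS ONLY (no `def`, no instance, no notation,
no axiom, no `sorry`).  Cell `pub/hodgecm-mathlib`, ENGINE T1 (crux H413 = `stmt-HodgeConjecture-24833`); floor-1 preparation, count-neutral, under books
rows #111 (S-d) ∕ #88 (ST-∞) (ROAD-Sd §2 (V2): the function the limit formulas (L-cont)∕(L-jump) differentiate is the GLOBAL torus orbital function
`z ↦ Φ(t(z), f)` on `T_∞ = (S¹)^{W × N}`; ★ FILE A `ArchLocalTorusOrbitalContinuity` proved joint properness and continuity PER PLACE in any signature,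
this file transports them to `G′_∞ ≃ₜ* Π_w G_w` (★ `archPiEquivCM`, ★ `archPiEquivCM_archDiagTorus`)); author F0P3a-p06 (g9) (LEAD DESK WORDS T7-32 ∕ T7-39).

WHAT IS PROVED (CM field `L`, `α_i ≠ 0`, `t(z) = archDiagTorus L N α z`, regular = `∀ w, z_w injective` = ★ `isRegularElt_archDiagTorus_iff`, an OPEN set by ★ `Literature.Topology.isOpen_setOf_forall_injective`).
* **`isCompact_setOf_exists_conj_archDiagTorus_mem` — GLOBAL JOINT PROPERNESS**: `{g ∈ G′_∞ | ∃ z ∈ K, g·t(z)·g⁻¹ ∈ C}` is compact for compact `K ⊆ T_reg`,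
  compact `C` (inside `e⁻¹(Π_w S_w)` for the per-place compact sets `S_w` of ★ FILE A); `hasCompactSupport_comp_conj_archDiagTorus`, `integrable_comp_conj_archDiagTorus`;
* **`continuousOn_integral_comp_conj_archDiagTorus`**: `z ↦ ∫_{G′_∞} f(g·t(z)·g⁻¹) dν(g)` is `ContinuousOn {z | ∀ w, Injective (z w)}` for `f ∈ C_c(G′_∞, E)` and
  `ν` finite on compacts;
* `integral_descConj_archDiagTorus_eq_inv_smul` — the GLOBAL fixed-quotient torus term of ★ `ArchTorusOrbitalFunction` §4 unfolded AT EVERY `z`: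
  `∫ descConj (t z) T_∞ f d(dν∕dt_T) = t_T(T_∞)⁻¹ • ∫ f(g·t(z)·g⁻¹) dν` (`T_∞` compact); **`continuousOn_integral_descConj_archDiagTorus_of_hasCompactSupport`**
  (it is continuous on the regular set); `orbitalIntegral_archDiagTorus_eq_inv_smul` (at a regular `z` it IS the Weil-form orbital integral
  `O_{t(z)}(f; dν∕dρ_z)`, ★ `orbitalIntegral_archDiagTorus_eq_integral_descConj`).  Consumers: F0P3a-p02's junction `ArchTorusOrbitalFunctionAtPoint` (j3)
  («`z ↦ Φ^st_∞(t z, a)` continuous on `T_reg`») discharges its continuity hypothesis by name here.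
NOT HERE: `C^∞` on `T_reg`; behaviour at the singular set ((L-jump), (V9)).  HONEST LABEL: HC_CM is proved only modulo the printed citations until rung 0
closes; this file is analysis on a real group and pays nothing by itself.

## References
* [Rogawski1990] J. D. Rogawski, *Automorphic Representations of Unitary Groups in Three Variables*, Ann. of Math. Stud. 123 (1990), §3.1 p. 19, §8.3 p. 122
  (orbital integrals on `T_reg`), §4.9 p. 54, §1.7 p. 6.
* [BorelJacquet1979] A. Borel, H. Jacquet, *Automorphic forms and automorphic representations*, PSPM 33.1 (1979), §4.1 (`G_∞ = Π_v G(F_v)`).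
* [DeitmarEchterhoff2014] A. Deitmar, S. Echterhoff, *Principles of Harmonic Analysis*, 2nd ed. (2014), Lemma 9.3.3, Cor. 1.5.4.
* [Folland1995] G. B. Folland, *A Course in Abstract Harmonic Analysis* (1995), §2.6 (2.52).
* [Shelstad1979] D. Shelstad, *Characters and inner forms of a quasi-split group over ℝ*, Compositio Math. 39 (1979), §4.
* [BrockerTomDieck1985] Th. Bröcker, T. tom Dieck, *Representations of Compact Lie Groups*, GTM 98 (1985), IV (3.1).
-/

set_option autoImplicit false

noncomputable section

open MeasureTheory Measure NumberField NumberField.InfinitePlace Filter Topology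
open Literature.MeasureTheory.Group
open scoped Matrix MatrixGroups

namespace Literature.NumberTheory.Automorphic.UnitaryGroup

section Global

variable (L : Type) [Field L] [NumberField L] [IsCMField L] (N : ℕ) (α : Fin N → L)

/-- **GLOBAL JOINT PROPERNESS over the regular set of `T_∞ ≤ G′_∞ = U(diag α)(L⁺ ⊗ ℝ)`**: for compact `K ⊆ T_reg` and compact `C ⊆ G′_∞`,
`{g | ∃ z ∈ K, g·t(z)·g⁻¹ ∈ C}` is compact — transported from the per-place statement ★ `isCompact_setOf_exists_conj_circleDiagonal_mem` through
`G′_∞ ≃ₜ* Π_w G_w` (★ `archPiEquivCM`, ★ `archPiEquivCM_archDiagTorus`). [cite: Rogawski1990, §8.3 p. 122; §3.1 p. 19] [cite: BorelJacquet1979, §4.1]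
[cite: DeitmarEchterhoff2014, Lemma 9.3.3] -/
theorem isCompact_setOf_exists_conj_archDiagTorus_mem (hα : ∀ i, α i ≠ 0)
    {K : Set ({w : InfinitePlace L // IsComplex w} → Fin N → Circle)} (hK : IsCompact K) (hKreg : K ⊆ {z | ∀ w, Function.Injective (z w)})
    {C : Set (arch (↥(maximalRealSubfield L)) L (IsCMField.complexConj L) N (Matrix.diagonal α))} (hC : IsCompact C) :
    IsCompact {g : arch (↥(maximalRealSubfield L)) L (IsCMField.complexConj L) N (Matrix.diagonal α) | ∃ z ∈ K,
      g * archDiagTorus L N α z * g⁻¹ ∈ C} := by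
  -- a compact `B ⊆ G′_∞` containing every such `g`: the preimage of the product of the per-place compact sets
  obtain ⟨B, hBc, hBmem⟩ : ∃ B : Set (arch (↥(maximalRealSubfield L)) L (IsCMField.complexConj L) N (Matrix.diagonal α)), IsCompact B ∧
      ∀ g z, z ∈ K → g * archDiagTorus L N α z * g⁻¹ ∈ C → g ∈ B := by
    have hSw : ∀ w : {w : InfinitePlace L // IsComplex w}, IsCompact {gw : archLocal L N (Matrix.diagonal α) w |
        ∃ zw ∈ (fun z : {w : InfinitePlace L // IsComplex w} → Fin N → Circle => z w) '' K,
          gw * ⟨circleDiagonal N zw, circleDiagonal_mem_archLocal_diagonal L N α w zw⟩ * gw⁻¹ ∈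
            (fun x => archPiEquivCM N L (Matrix.diagonal α) x w) '' C} := fun w =>
      isCompact_setOf_exists_conj_circleDiagonal_mem L N α w hα (hK.image (continuous_apply w))
        (by rintro _ ⟨z, hz, rfl⟩; exact hKreg hz w) (hC.image ((continuous_apply w).comp (archPiEquivCM N L (Matrix.diagonal α)).continuous))
    have hBc := (isCompact_univ_pi hSw).image (archPiEquivCM N L (Matrix.diagonal α)).symm.continuous
    refine ⟨_, hBc, fun g z hz hgz => ?_⟩
    have hpi : archPiEquivCM N L (Matrix.diagonal α) g ∈ Set.univ.pi fun w => {gw : archLocal L N (Matrix.diagonal α) w |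
        ∃ zw ∈ (fun z : {w : InfinitePlace L // IsComplex w} → Fin N → Circle => z w) '' K,
          gw * ⟨circleDiagonal N zw, circleDiagonal_mem_archLocal_diagonal L N α w zw⟩ * gw⁻¹ ∈
            (fun x => archPiEquivCM N L (Matrix.diagonal α) x w) '' C} := by
      simp only [Set.mem_univ_pi, Set.mem_setOf_eq]
      intro w
      have hw : archPiEquivCM N L (Matrix.diagonal α) (g * archDiagTorus L N α z * g⁻¹) w =
          archPiEquivCM N L (Matrix.diagonal α) g w * ⟨circleDiagonal N (z w), circleDiagonal_mem_archLocal_diagonal L N α w (z w)⟩ *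
            (archPiEquivCM N L (Matrix.diagonal α) g w)⁻¹ := by
        rw [map_mul, map_mul, map_inv, Pi.mul_apply, Pi.mul_apply, Pi.inv_apply, archPiEquivCM_archDiagTorus]
      refine ⟨z w, Set.mem_image_of_mem (fun z : {w : InfinitePlace L // IsComplex w} → Fin N → Circle => z w) hz, ?_⟩
      rw [← hw]
      exact Set.mem_image_of_mem (fun x => archPiEquivCM N L (Matrix.diagonal α) x w) hgz
    have hg := Set.mem_image_of_mem (archPiEquivCM N L (Matrix.diagonal α)).symm hpi
    rwa [ContinuousMulEquiv.symm_apply_apply] at hg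
  -- the pair set `M = {(g, z) | z ∈ K, g·t(z)·g⁻¹ ∈ C}` is closed, inside `B × K`
  obtain ⟨M, hM⟩ : ∃ M : Set (arch (↥(maximalRealSubfield L)) L (IsCMField.complexConj L) N (Matrix.diagonal α) ×
      ({w : InfinitePlace L // IsComplex w} → Fin N → Circle)), M = {p | p.2 ∈ K ∧ p.1 * archDiagTorus L N α p.2 * p.1⁻¹ ∈ C} := ⟨_, rfl⟩
  have hconj : Continuous fun p : arch (↥(maximalRealSubfield L)) L (IsCMField.complexConj L) N (Matrix.diagonal α) ×
      ({w : InfinitePlace L // IsComplex w} → Fin N → Circle) => p.1 * archDiagTorus L N α p.2 * p.1⁻¹ :=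
    (continuous_fst.mul ((continuous_archDiagTorus L N α).comp continuous_snd)).mul continuous_fst.inv
  have hMclosed : IsClosed M := by
    rw [hM]; exact (hK.isClosed.preimage continuous_snd).inter (hC.isClosed.preimage hconj)
  have hMsub : M ⊆ B ×ˢ K := by
    rw [hM]; rintro ⟨g, z⟩ ⟨hzK, hgC⟩; exact ⟨hBmem g z hzK hgC, hzK⟩
  have hMc : IsCompact M := (hBc.prod hK).of_isClosed_subset hMclosed hMsub
  have hS : {g : arch (↥(maximalRealSubfield L)) L (IsCMField.complexConj L) N (Matrix.diagonal α) | ∃ z ∈ K,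
      g * archDiagTorus L N α z * g⁻¹ ∈ C} = Prod.fst '' M := by
    rw [hM]
    ext g
    simp only [Set.mem_setOf_eq, Set.mem_image, Prod.exists, exists_and_right, exists_eq_right]
  rw [hS]
  exact hMc.image continuous_fst

/-- Compact support of `g ↦ f(g·t(z)·g⁻¹)` on `G′_∞` at a regular `z`. [cite: Rogawski1990, §8.3 p. 122] [cite: DeitmarEchterhoff2014, Lemma 9.3.3] -/
theorem hasCompactSupport_comp_conj_archDiagTorus (hα : ∀ i, α i ≠ 0) {z : {w : InfinitePlace L // IsComplex w} → Fin N → Circle}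
    (hz : ∀ w, Function.Injective (z w)) {E : Type*} [Zero E]
    (f : arch (↥(maximalRealSubfield L)) L (IsCMField.complexConj L) N (Matrix.diagonal α) → E) (hfc : HasCompactSupport f) :
    HasCompactSupport fun g : arch (↥(maximalRealSubfield L)) L (IsCMField.complexConj L) N (Matrix.diagonal α) =>
      f (g * archDiagTorus L N α z * g⁻¹) := by
  refine HasCompactSupport.intro (isCompact_setOf_exists_conj_archDiagTorus_mem L N α hα isCompact_singleton
    (Set.singleton_subset_iff.mpr hz) hfc.isCompact) fun g hg => ?_
  exact image_eq_zero_of_notMem_tsupport fun h => hg ⟨z, rfl, h⟩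

variable [MeasurableSpace (arch (↥(maximalRealSubfield L)) L (IsCMField.complexConj L) N (Matrix.diagonal α))]
  [BorelSpace (arch (↥(maximalRealSubfield L)) L (IsCMField.complexConj L) N (Matrix.diagonal α))]
  {E : Type*} [NormedAddCommGroup E]

/-- **THE GLOBAL CONJUGATION AVERAGE `z ↦ ∫_{G′_∞} f(g·t(z)·g⁻¹) dν(g)` IS CONTINUOUS ON THE REGULAR SET** (any signatures at the places; `f` continuous
with compact support, `ν` finite on compacts). [cite: Rogawski1990, §8.3 p. 122] [cite: Shelstad1979, §4] -/
theorem continuousOn_integral_comp_conj_archDiagTorus [NormedSpace ℝ E] (hα : ∀ i, α i ≠ 0)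
    (ν : Measure (arch (↥(maximalRealSubfield L)) L (IsCMField.complexConj L) N (Matrix.diagonal α))) [IsFiniteMeasureOnCompacts ν]
    (f : arch (↥(maximalRealSubfield L)) L (IsCMField.complexConj L) N (Matrix.diagonal α) → E) (hf : Continuous f) (hfc : HasCompactSupport f) :
    ContinuousOn (fun z : {w : InfinitePlace L // IsComplex w} → Fin N → Circle => ∫ g, f (g * archDiagTorus L N α z * g⁻¹) ∂ν)
      {z | ∀ w, Function.Injective (z w)} := by
  intro z₀ hz₀
  obtain ⟨K, hKnhds, hKsub, hK⟩ := local_compact_nhds (Literature.Topology.isOpen_setOf_forall_injective.mem_nhds hz₀)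
  have hS := isCompact_setOf_exists_conj_archDiagTorus_mem L N α hα hK hKsub hfc.isCompact
  have hcont : ContinuousOn (fun z : {w : InfinitePlace L // IsComplex w} → Fin N → Circle =>
      ∫ g, f (g * archDiagTorus L N α z * g⁻¹) ∂ν) K := by
    refine continuousOn_integral_of_compact_support hS ?_ ?_
    · exact (hf.comp ((continuous_snd.mul ((continuous_archDiagTorus L N α).comp continuous_fst)).mul continuous_snd.inv)).continuousOn
    · intro z g hz hg
      exact image_eq_zero_of_notMem_tsupport fun h => hg ⟨z, hz, h⟩
  exact ((continuousWithinAt_iff_continuousAt hKnhds).mp (hcont z₀ (mem_of_mem_nhds hKnhds))).continuousWithinAt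

/-- The global conjugation integrand at a regular `z` is integrable. [cite: Rogawski1990, §8.3 p. 122] -/
theorem integrable_comp_conj_archDiagTorus [NormedSpace ℝ E] (hα : ∀ i, α i ≠ 0)
    (ν : Measure (arch (↥(maximalRealSubfield L)) L (IsCMField.complexConj L) N (Matrix.diagonal α))) [IsFiniteMeasureOnCompacts ν]
    {z : {w : InfinitePlace L // IsComplex w} → Fin N → Circle} (hz : ∀ w, Function.Injective (z w))
    (f : arch (↥(maximalRealSubfield L)) L (IsCMField.complexConj L) N (Matrix.diagonal α) → E) (hf : Continuous f) (hfc : HasCompactSupport f) :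
    Integrable (fun g : arch (↥(maximalRealSubfield L)) L (IsCMField.complexConj L) N (Matrix.diagonal α) =>
      f (g * archDiagTorus L N α z * g⁻¹)) ν :=
  (hf.comp ((continuous_id.mul continuous_const).mul continuous_id.inv)).integrable_of_hasCompactSupport
    (hasCompactSupport_comp_conj_archDiagTorus L N α hα hz f hfc)

omit [MeasurableSpace (arch (↥(maximalRealSubfield L)) L (IsCMField.complexConj L) N (Matrix.diagonal α))]
  [BorelSpace (arch (↥(maximalRealSubfield L)) L (IsCMField.complexConj L) N (Matrix.diagonal α))] in
/-- The integrand `y T_∞ ↦ f(y·t(z)·y⁻¹)` of the global fixed-quotient torus term is continuous on `G′_∞ ⧸ T_∞` (any `z`). [cite: Rogawski1990, §8.3 p. 122] -/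
theorem continuous_descConj_archDiagTorus {Y : Type*} [TopologicalSpace Y] (z : {w : InfinitePlace L // IsComplex w} → Fin N → Circle)
    (f : arch (↥(maximalRealSubfield L)) L (IsCMField.complexConj L) N (Matrix.diagonal α) → Y) (hf : Continuous f) :
    Continuous (descConj (archDiagTorus L N α z) (archDiagTorus L N α).range (range_archDiagTorus_comm_apply L N α z) f) := by
  rw [(QuotientGroup.isQuotientMap_mk _).continuous_iff, descConj_comp_mk]
  exact hf.comp ((continuous_id.mul continuous_const).mul continuous_id.inv)

variable [NormedSpace ℝ E]
  [LocallyCompactSpace (arch (↥(maximalRealSubfield L)) L (IsCMField.complexConj L) N (Matrix.diagonal α))]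
  [SecondCountableTopology (arch (↥(maximalRealSubfield L)) L (IsCMField.complexConj L) N (Matrix.diagonal α))]
  (ν : Measure (arch (↥(maximalRealSubfield L)) L (IsCMField.complexConj L) N (Matrix.diagonal α))) [ν.IsHaarMeasure] [ν.IsMulRightInvariant]
  (tT : Measure (archDiagTorus L N α).range) [tT.IsHaarMeasure] [tT.IsInvInvariant]
  [MeasurableSpace (arch (↥(maximalRealSubfield L)) L (IsCMField.complexConj L) N (Matrix.diagonal α) ⧸ (archDiagTorus L N α).range)]
  [BorelSpace (arch (↥(maximalRealSubfield L)) L (IsCMField.complexConj L) N (Matrix.diagonal α) ⧸ (archDiagTorus L N α).range)]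

/-- **THE GLOBAL FIXED-QUOTIENT TORUS TERM UNFOLDED, AT EVERY `z`**: `T_∞` is compact (★ `isCompact_coe_range_archDiagTorus`), so
`F_f(z) = ∫ descConj (t z) T_∞ f d(dν∕dt_T) = t_T(T_∞)⁻¹ • ∫_{G′_∞} f(g·t(z)·g⁻¹) dν(g)` (the global twin of ★ (V2)-Q `integral_descConj_circleDiagonal_eq_inv_smul`).
[cite: Rogawski1990, §1.7 p. 6; §8.3 p. 122] [cite: Folland1995, §2.6 (2.52)] -/
theorem integral_descConj_archDiagTorus_eq_inv_smul (z : {w : InfinitePlace L // IsComplex w} → Fin N → Circle)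
    (f : arch (↥(maximalRealSubfield L)) L (IsCMField.complexConj L) N (Matrix.diagonal α) → E) (hf : Continuous f) :
    ∫ y, descConj (archDiagTorus L N α z) (archDiagTorus L N α).range (range_archDiagTorus_comm_apply L N α z) f y
        ∂(quotientMeasure _ tT (isClosed_coe_range_archDiagTorus L N α) ν) =
      (tT.real Set.univ)⁻¹ • ∫ g, f (g * archDiagTorus L N α z * g⁻¹) ∂ν := by
  haveI : CompactSpace (archDiagTorus L N α).range := isCompact_iff_compactSpace.mp (isCompact_coe_range_archDiagTorus L N α)
  haveI : IsClosed (((archDiagTorus L N α).range :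
      Subgroup (arch (↥(maximalRealSubfield L)) L (IsCMField.complexConj L) N (Matrix.diagonal α))) :
        Set (arch (↥(maximalRealSubfield L)) L (IsCMField.complexConj L) N (Matrix.diagonal α))) :=
    isClosed_coe_range_archDiagTorus L N α
  rw [integral_quotientMeasure_eq_inv_smul _ tT ν _ (continuous_descConj_archDiagTorus L N α z f hf).stronglyMeasurable]
  rfl

/-- **THE GLOBAL TORUS ORBITAL FUNCTION `F_f` IS CONTINUOUS ON THE REGULAR SET** — `f ∈ C_c(G′_∞)`, any signatures (the two previous theorems).
[cite: Rogawski1990, §8.3 p. 122] [cite: Shelstad1979, §4] -/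
theorem continuousOn_integral_descConj_archDiagTorus_of_hasCompactSupport (hα : ∀ i, α i ≠ 0)
    (f : arch (↥(maximalRealSubfield L)) L (IsCMField.complexConj L) N (Matrix.diagonal α) → E) (hf : Continuous f) (hfc : HasCompactSupport f) :
    ContinuousOn (fun z : {w : InfinitePlace L // IsComplex w} → Fin N → Circle =>
      ∫ y, descConj (archDiagTorus L N α z) (archDiagTorus L N α).range (range_archDiagTorus_comm_apply L N α z) f y
        ∂(quotientMeasure _ tT (isClosed_coe_range_archDiagTorus L N α) ν)) {z | ∀ w, Function.Injective (z w)} := by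
  have h : (fun z : {w : InfinitePlace L // IsComplex w} → Fin N → Circle =>
      ∫ y, descConj (archDiagTorus L N α z) (archDiagTorus L N α).range (range_archDiagTorus_comm_apply L N α z) f y
        ∂(quotientMeasure _ tT (isClosed_coe_range_archDiagTorus L N α) ν)) =
      fun z => (tT.real Set.univ)⁻¹ • ∫ g, f (g * archDiagTorus L N α z * g⁻¹) ∂ν :=
    funext fun z => integral_descConj_archDiagTorus_eq_inv_smul L N α ν tT z f hf
  rw [h]
  exact (continuousOn_integral_comp_conj_archDiagTorus L N α hα ν f hf hfc).const_smul _

/-- **THE REGULAR-POINT WEIL-FORM ORBITAL INTEGRAL ON `G′_∞`, UNFOLDED**: for regular `z` and `ρ = t_T ∘ (Z(t z) = T_∞)⁻¹`,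
`orbitalIntegral (t z) f (dν∕dρ) = t_T(T_∞)⁻¹ • ∫_{G′_∞} f(g·t(z)·g⁻¹) dν(g)` (★ `orbitalIntegral_archDiagTorus_eq_integral_descConj` + the unfolding) — so the
function whose continuity on `T_reg` the previous theorem asserts IS `z ↦ Φ(t(z), f)` there. [cite: Rogawski1990, §4.9 p. 54; §8.3 p. 122] [cite: Folland1995, §2.6 (2.52)] -/
theorem orbitalIntegral_archDiagTorus_eq_inv_smul (hα : ∀ i, α i ≠ 0)
    {z : {w : InfinitePlace L // IsComplex w} → Fin N → Circle} (hz : ∀ w, Function.Injective (z w))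
    (ρ : Measure (Subgroup.centralizer ({archDiagTorus L N α z} : Set (arch (↥(maximalRealSubfield L)) L (IsCMField.complexConj L) N (Matrix.diagonal α)))))
    [ρ.IsHaarMeasure] [ρ.IsInvInvariant]
    (hρ : ρ = tT.map (MulEquiv.subgroupCongr (centralizer_archDiagTorus_eq_range L N α hα hz).symm))
    [MeasurableSpace (arch (↥(maximalRealSubfield L)) L (IsCMField.complexConj L) N (Matrix.diagonal α) ⧸
      Subgroup.centralizer ({archDiagTorus L N α z} : Set (arch (↥(maximalRealSubfield L)) L (IsCMField.complexConj L) N (Matrix.diagonal α))))]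
    [BorelSpace (arch (↥(maximalRealSubfield L)) L (IsCMField.complexConj L) N (Matrix.diagonal α) ⧸
      Subgroup.centralizer ({archDiagTorus L N α z} : Set (arch (↥(maximalRealSubfield L)) L (IsCMField.complexConj L) N (Matrix.diagonal α))))]
    (f : arch (↥(maximalRealSubfield L)) L (IsCMField.complexConj L) N (Matrix.diagonal α) → E) (hf : Continuous f) :
    orbitalIntegral (archDiagTorus L N α z) f (quotientMeasure _ ρ (isClosed_coe_centralizer_singleton _) ν) =
      (tT.real Set.univ)⁻¹ • ∫ g, f (g * archDiagTorus L N α z * g⁻¹) ∂ν := by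
  rw [orbitalIntegral_archDiagTorus_eq_integral_descConj L N α hα ν tT hz ρ hρ f, integral_descConj_archDiagTorus_eq_inv_smul L N α ν tT z f hf]

end Global

end Literature.NumberTheory.Automorphic.UnitaryGroup

end
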